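import Literature.Combinatorics.SimpleGraph.LovaszTheta
import Literature.LinearAlgebra.Matrix.PowerMethodTrace
import HarnessLib

/-!
# The spectraplex, the penalised theta objective, and the extraction of a lower bound on `ϑ`

Topic `Combinatorics/SimpleGraph`, continuing `LovaszTheta.lean` (`lovaszTheta H`, the
semidefinite maximisation form `ϑ(H) = sup { Σᵤᵥ Bᵤᵥ : B ⪰ 0, Tr B = 1, Bᵤᵥ = 0 on E(H) }`,
`IsThetaFeasible`, `entrySum`). These are the convex-geometric ingredients of a first-order
approximation scheme for `ϑ` (Frank–Wolfe over the **spectraplex**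
`Δ = {B ⪰ 0, Tr B = 1}` applied to the **penalised objective**
`f_M(B) = Σᵤᵥ Bᵤᵥ - M Σ_{uv ∈ E⃗} Bᵤᵥ²`, after Hazan 2008 / Jaggi 2011, Alg. 6), towards the
discharge of `Literature.Computability.Complexity.GLS1981_thetaApprox_unary_FP`. Everything here
is PROVED:

* `IsSpectraplex B` (`B ⪰ 0`, `Tr B = 1`; = `IsThetaFeasible ⊥ B`), with `0 ≤ Bᵤᵤ ≤ 1`,
  `|Bᵤᵥ| ≤ 1`, `0 ≤ Σ Bᵤᵥ ≤ |V|`, `Σ Bᵤᵥ² ≤ 1`, convex combinations;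
* the penalised objective `penaltyObj H M B`, its gradient matrix `penaltyGrad H M B`
  (entries `1 - 2M Bᵤᵥ [uv ∈ E⃗]`, bounded by `1 + 2M`, symmetric) and the EXACT second-order
  Taylor identity of this quadratic (`penaltyObj_eq_taylor`):
  `f(Y) = f(B) + ⟨∇f(B), Y - B⟩ - M q(Y - B)`, `q = edgeSqSum`; the curvature bound
  `q(W - B) ≤ 4` on `Δ` (`edgeSqSum_sub_le_four`);
* **extraction** (`entrySum_sub_le_lovaszTheta`): for `B ∈ Δ` whose entries on edges are at most
  `η` in absolute value, `Σ Bᵤᵥ - |V|³ η ≤ ϑ(H)` — the matrix `(B - B_E + |V|η·1)/(1 + |V|²η)` is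
  theta-feasible (positive semidefinite by the Gershgorin-type bound of `PowerMethodTrace.lean`);
  consequently (`penaltyObj_le`) `f_M(B) ≤ ϑ(H) + |V|⁶/(4M)` for EVERY `B ∈ Δ` and `M > 0`
  (`|V|³η - Mη² ≤ |V|⁶/4M`): the penalised maximum over `Δ` over-estimates `ϑ` by at most `|V|⁶/4M`
  — an elementary substitute for semidefinite duality;
* the linear bound on the spectraplex in Frobenius form (`frobInner_le_topEigenvalue`):
  `⟨G, B⟩ ≤ λ_max(G)` for `B ∈ Δ`.

## References

* L. Lovász, IEEE Trans. Inform. Theory 25 (1979) 1–7 [Lovasz1979]; M. Grötschel, L. Lovász,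
  A. Schrijver, Combinatorica 1 (1981) 169–197, §6 [GrotschelLovaszSchrijver1981].
* M. Jaggi, *Convex optimization without projection steps*, arXiv:1108.1170 (2011), §3–§4
  (Alg. 6 "Hazan's algorithm", Lemma 23 "diameter of the spectahedron") [Jaggi2011];
  E. Hazan, LATIN 2008 [Hazan2008].
-/

noncomputable section

open Matrix Finset

namespace Literature.Combinatorics.SimpleGraph

open Literature.LinearAlgebra.Matrix

variable {V : Type*} [Fintype V] [DecidableEq V]

/-! ### The spectraplex -/

/-- The **spectraplex** `Δ = {B ⪰ 0, Tr B = 1}` of real matrices (Jaggi 2011, §4: "the PSD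
matrices of unit trace … sometimes called the Spectahedron"). [cite: Jaggi2011, §4 (chunk p0020)] -/
structure IsSpectraplex (B : Matrix V V ℝ) : Prop where
  /-- `B` is positive semidefinite -/
  posSemidef : B.PosSemidef
  /-- `Tr B = 1` -/
  trace_eq_one : B.trace = 1

namespace IsSpectraplex

variable {B : Matrix V V ℝ}

omit [DecidableEq V] in
/-- The spectraplex is the theta-feasible set of the edgeless graph. [folklore] -/
theorem isThetaFeasible_bot (hB : IsSpectraplex B) : IsThetaFeasible (⊥ : _root_.SimpleGraph V) B :=
  ⟨hB.posSemidef, hB.trace_eq_one, fun _ _ h => h.elim⟩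

omit [DecidableEq V] in
/-- A theta-feasible matrix lies in the spectraplex. [folklore] -/
theorem of_isThetaFeasible {H : _root_.SimpleGraph V} (hB : IsThetaFeasible H B) : IsSpectraplex B :=
  ⟨hB.posSemidef, hB.trace_eq_one⟩

omit [DecidableEq V] in
/-- Symmetry of a spectraplex matrix, entrywise. [folklore] -/
theorem apply_comm (hB : IsSpectraplex B) (u v : V) : B v u = B u v := by
  have h := congrFun (congrFun hB.posSemidef.1 u) v
  simpa [conjTranspose_apply] using h

omit [DecidableEq V] in
/-- Diagonal entries are nonnegative. [folklore] -/
theorem diag_nonneg (hB : IsSpectraplex B) (u : V) : 0 ≤ B u u := hB.posSemidef.diag_nonneg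

omit [DecidableEq V] in
/-- Diagonal entries are at most one (they are nonnegative and sum to the trace). [folklore] -/
theorem diag_le_one (hB : IsSpectraplex B) (u : V) : B u u ≤ 1 := by
  have h : B u u ≤ ∑ w, B w w :=
    single_le_sum (f := fun w => B w w) (fun w _ => hB.diag_nonneg w) (mem_univ u)
  have htr : ∑ w, B w w = 1 := by rw [← hB.trace_eq_one, Matrix.trace]; rfl
  linarith

/-- Entries are at most one in absolute value (`2|Bᵤᵥ| ≤ Bᵤᵤ + Bᵥᵥ ≤ 2`). [folklore] -/
theorem abs_apply_le_one (hB : IsSpectraplex B) (u v : V) : |B u v| ≤ 1 := by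
  have h1 := two_mul_apply_le hB.posSemidef u v
  have h2 : -(2 * B u v) ≤ B u u + B v v := by
    have h := hB.posSemidef.dotProduct_mulVec_nonneg (indVec {u} + indVec {v})
    rw [star_trivial, mulVec_add, dotProduct_add, add_dotProduct, add_dotProduct,
      indVec_dotProduct_mulVec_indVec, indVec_dotProduct_mulVec_indVec,
      indVec_dotProduct_mulVec_indVec, indVec_dotProduct_mulVec_indVec] at h
    simp only [sum_singleton] at h
    rw [hB.apply_comm u v] at h
    linarith
  have hu := hB.diag_le_one u
  have hv := hB.diag_le_one v
  rw [abs_le]; constructor <;> linarith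

/-- `0 ≤ Σ Bᵤᵥ = 𝟙ᵀB𝟙` on the spectraplex. [folklore] -/
theorem entrySum_nonneg (hB : IsSpectraplex B) : 0 ≤ entrySum B := by
  rw [entrySum_eq]
  have := hB.posSemidef.dotProduct_mulVec_nonneg (indVec univ)
  rwa [star_trivial] at this

/-- `Σ Bᵤᵥ ≤ |V|` on the spectraplex. [folklore] -/
theorem entrySum_le_card (hB : IsSpectraplex B) : entrySum B ≤ Fintype.card V :=
  Literature.Combinatorics.SimpleGraph.entrySum_le_card hB.isThetaFeasible_bot

/-- `Σ Bᵤᵥ² ≤ 1` on the spectraplex (Frobenius norm at most the trace; Jaggi 2011, Lemma 23).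
[cite: Jaggi2011, Lemma 23 (chunk p0024)] -/
theorem sum_sq_le_one (hB : IsSpectraplex B) : ∑ u, ∑ v, B u v ^ 2 ≤ 1 := by
  have h := sum_sq_le_trace_sq hB.posSemidef
  rwa [hB.trace_eq_one, one_pow] at h

omit [DecidableEq V] in
/-- The spectraplex is convex. [folklore] -/
theorem convexComb {W : Matrix V V ℝ} (hB : IsSpectraplex B) (hW : IsSpectraplex W) {α : ℝ}
    (h0 : 0 ≤ α) (h1 : α ≤ 1) : IsSpectraplex ((1 - α) • B + α • W) where
  posSemidef := (hB.posSemidef.smul (sub_nonneg.2 h1)).add (hW.posSemidef.smul h0)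
  trace_eq_one := by
    rw [trace_add, trace_smul, trace_smul, hB.trace_eq_one, hW.trace_eq_one]; simp

omit [DecidableEq V] in
/-- A positive semidefinite matrix of positive trace, normalised, lies in the spectraplex.
[folklore] -/
theorem of_posSemidef_div {P : Matrix V V ℝ} (hP : P.PosSemidef) (htr : 0 < P.trace) :
    IsSpectraplex (P.trace⁻¹ • P) where
  posSemidef := hP.smul (inv_nonneg.2 htr.le)
  trace_eq_one := by rw [trace_smul, smul_eq_mul, inv_mul_cancel₀ htr.ne']

end IsSpectraplex

/-- `|V|⁻¹ · 1` lies in the spectraplex (nonempty vertex set). [folklore] -/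
theorem isSpectraplex_smul_one [Nonempty V] :
    IsSpectraplex ((Fintype.card V : ℝ)⁻¹ • (1 : Matrix V V ℝ)) :=
  IsSpectraplex.of_isThetaFeasible (isThetaFeasible_smul_one (⊥ : _root_.SimpleGraph V))

/-! ### The Frobenius pairing -/

/-- The Frobenius pairing `⟨X, Y⟩ = Σᵤᵥ Xᵤᵥ Yᵤᵥ`. [folklore] -/
def frobInner (X Y : Matrix V V ℝ) : ℝ := ∑ u, ∑ v, X u v * Y u v

omit [DecidableEq V] in
/-- For symmetric `Y`, `⟨X, Y⟩ = Tr(X Y)`. [folklore] -/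
theorem frobInner_eq_trace_mul (X : Matrix V V ℝ) {Y : Matrix V V ℝ} (hY : ∀ u v, Y v u = Y u v) :
    frobInner X Y = (X * Y).trace := by
  simp only [frobInner, Matrix.trace, Matrix.diag, Matrix.mul_apply]
  exact sum_congr rfl fun u _ => sum_congr rfl fun v _ => by rw [hY u v]

omit [DecidableEq V] in
/-- Linearity of the pairing in the second argument: subtraction. [folklore] -/
theorem frobInner_sub (X Y Z : Matrix V V ℝ) : frobInner X (Y - Z) = frobInner X Y - frobInner X Z := by
  simp only [frobInner, Matrix.sub_apply, mul_sub, sum_sub_distrib]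

omit [DecidableEq V] in
/-- Linearity of the pairing in the second argument: scalars. [folklore] -/
theorem frobInner_smul (X Y : Matrix V V ℝ) (a : ℝ) : frobInner X (a • Y) = a * frobInner X Y := by
  simp only [frobInner, Matrix.smul_apply, smul_eq_mul, mul_sum]
  exact sum_congr rfl fun u _ => sum_congr rfl fun v _ => by ring

omit [DecidableEq V] in
/-- Linearity of the pairing in the second argument: sums. [folklore] -/
theorem frobInner_add (X Y Z : Matrix V V ℝ) : frobInner X (Y + Z) = frobInner X Y + frobInner X Z := by
  simp only [frobInner, Matrix.add_apply, mul_add, sum_add_distrib]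

omit [DecidableEq V] in
/-- `⟨X, 1⟩`... rather `⟨1, ·⟩`: the pairing with the identity is the trace. [folklore] -/
theorem frobInner_one_left [DecidableEq V] (Y : Matrix V V ℝ) : frobInner (1 : Matrix V V ℝ) Y = Y.trace := by
  simp only [frobInner, Matrix.one_apply, ite_mul, one_mul, zero_mul, sum_ite_eq, mem_univ, if_true,
    Matrix.trace, Matrix.diag]

/-- **Linear functions on the spectraplex**: `⟨G, B⟩ ≤ λ_max(G)` for symmetric `G` and `B ∈ Δ`
(Jaggi 2011, §4.1: a linear function attains its maximum over the spectahedron at a top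
eigenvector). [cite: Jaggi2011, §4.1 (chunk p0021)] -/
theorem frobInner_le_topEigenvalue [Nonempty V] {G B : Matrix V V ℝ} (hG : G.IsHermitian)
    (hB : IsSpectraplex B) : frobInner G B ≤ topEigenvalue hG := by
  rw [frobInner_eq_trace_mul G hB.apply_comm]
  have h := trace_mul_le_topEigenvalue_mul_trace hG hB.posSemidef
  rwa [hB.trace_eq_one, mul_one] at h

/-! ### Linearity of the theta objective `Σ Bᵤᵥ` -/

omit [DecidableEq V] in
/-- `Σ (a • X)ᵤᵥ = a Σ Xᵤᵥ`. [folklore] -/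
theorem entrySum_smul (a : ℝ) (X : Matrix V V ℝ) : entrySum (a • X) = a * entrySum X := by
  simp only [entrySum, Matrix.smul_apply, smul_eq_mul, mul_sum]

omit [DecidableEq V] in
/-- `Σ (X + Y)ᵤᵥ = Σ Xᵤᵥ + Σ Yᵤᵥ`. [folklore] -/
theorem entrySum_add (X Y : Matrix V V ℝ) : entrySum (X + Y) = entrySum X + entrySum Y := by
  simp only [entrySum, Matrix.add_apply, sum_add_distrib]

omit [DecidableEq V] in
/-- `Σ (X - Y)ᵤᵥ = Σ Xᵤᵥ - Σ Yᵤᵥ`. [folklore] -/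
theorem entrySum_sub (X Y : Matrix V V ℝ) : entrySum (X - Y) = entrySum X - entrySum Y := by
  simp only [entrySum, Matrix.sub_apply, sum_sub_distrib]

/-- `Σ 1ᵤᵥ = |V|`. [folklore] -/
theorem entrySum_one : entrySum (1 : Matrix V V ℝ) = Fintype.card V := by
  simp [entrySum, Matrix.one_apply]

/-! ### The penalised objective and its Taylor identity -/

variable (H : _root_.SimpleGraph V) [DecidableRel H.Adj]

/-- The penalty `q(B) = Σ_{(u,v) : uv ∈ E} Bᵤᵥ²` (ordered pairs). [folklore] -/
def edgeSqSum (B : Matrix V V ℝ) : ℝ := ∑ u, ∑ v, if H.Adj u v then B u v ^ 2 else 0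

/-- The **penalised theta objective** `f_M(B) = Σᵤᵥ Bᵤᵥ - M q(B)`: on theta-feasible matrices it is
the objective `Σ Bᵤᵥ` of `lovaszTheta`, and the penalty replaces the constraints `Bᵤᵥ = 0`
(`uv ∈ E`). [folklore] -/
def penaltyObj (M : ℝ) (B : Matrix V V ℝ) : ℝ := entrySum B - M * edgeSqSum H B

/-- The gradient matrix `∇f_M(B)`: entries `1 - 2M Bᵤᵥ` on edges, `1` elsewhere. [folklore] -/
def penaltyGrad (M : ℝ) (B : Matrix V V ℝ) : Matrix V V ℝ :=
  fun u v => 1 - if H.Adj u v then 2 * M * B u v else 0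

/-- The edge part `B_E` of a matrix (entries on the edges of `H`, zero elsewhere). [folklore] -/
def edgePart (B : Matrix V V ℝ) : Matrix V V ℝ := fun u v => if H.Adj u v then B u v else 0

/-- The **extraction matrix** `(B - B_E + |V|η · 1) / (1 + |V|²η)`: theta-feasible for `B` in the
spectraplex with edge entries at most `η` in absolute value (`isThetaFeasible_extract`). [folklore] -/
def extract (η : ℝ) (B : Matrix V V ℝ) : Matrix V V ℝ :=
  (1 + (Fintype.card V : ℝ) ^ 2 * η)⁻¹ • (B - edgePart H B + ((Fintype.card V : ℝ) * η) • 1)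

variable {H}

omit [DecidableEq V] in
/-- The penalty is nonnegative. [folklore] -/
theorem edgeSqSum_nonneg (B : Matrix V V ℝ) : 0 ≤ edgeSqSum H B :=
  sum_nonneg fun u _ => sum_nonneg fun v _ => by split_ifs <;> positivity

omit [DecidableEq V] in
/-- The penalty vanishes on theta-feasible matrices. [folklore] -/
theorem edgeSqSum_eq_zero_of_feasible {B : Matrix V V ℝ} (hB : IsThetaFeasible H B) :
    edgeSqSum H B = 0 :=
  sum_eq_zero fun u _ => sum_eq_zero fun v _ => by
    split_ifs with h
    · rw [hB.apply_eq_zero h]; ring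
    · rfl

omit [DecidableEq V] in
/-- On theta-feasible matrices the penalised objective is the theta objective. [folklore] -/
theorem penaltyObj_of_feasible (M : ℝ) {B : Matrix V V ℝ} (hB : IsThetaFeasible H B) :
    penaltyObj H M B = entrySum B := by
  rw [penaltyObj, edgeSqSum_eq_zero_of_feasible hB, mul_zero, sub_zero]

omit [DecidableEq V] in
/-- The penalty is dominated by the full sum of squares. [folklore] -/
theorem edgeSqSum_le_sum_sq (B : Matrix V V ℝ) : edgeSqSum H B ≤ ∑ u, ∑ v, B u v ^ 2 :=
  sum_le_sum fun u _ => sum_le_sum fun v _ => by split_ifs <;> nlinarith [sq_nonneg (B u v)]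

omit [DecidableEq V] in
/-- **Exact Taylor identity of the quadratic objective**:
`f(Y) = f(B) + ⟨∇f(B), Y - B⟩ - M q(Y - B)`. [folklore] -/
theorem penaltyObj_eq_taylor (M : ℝ) (B Y : Matrix V V ℝ) :
    penaltyObj H M Y = penaltyObj H M B + frobInner (penaltyGrad H M B) (Y - B)
      - M * edgeSqSum H (Y - B) := by
  simp only [penaltyObj, entrySum, edgeSqSum, frobInner, penaltyGrad, Matrix.sub_apply, mul_sum,
    ← sum_sub_distrib, ← sum_add_distrib]
  refine sum_congr rfl fun u _ => sum_congr rfl fun v _ => ?_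
  split_ifs <;> ring

omit [Fintype V] [DecidableEq V] in
/-- The gradient matrix is symmetric when `B` is. [folklore] -/
theorem penaltyGrad_comm (M : ℝ) {B : Matrix V V ℝ} (hB : ∀ u v, B v u = B u v) (u v : V) :
    penaltyGrad H M B v u = penaltyGrad H M B u v := by
  simp only [penaltyGrad, hB u v, H.adj_comm u v]

omit [Fintype V] [DecidableEq V] in
/-- The gradient matrix is Hermitian (real symmetric) when `B` is symmetric. [folklore] -/
theorem isHermitian_penaltyGrad (M : ℝ) {B : Matrix V V ℝ} (hB : ∀ u v, B v u = B u v) :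
    (penaltyGrad H M B).IsHermitian := by
  ext u v
  simp only [conjTranspose_apply, star_trivial]
  exact penaltyGrad_comm (H := H) M hB u v

/-- **Entries of the gradient are bounded by `1 + 2M`** on the spectraplex (`|Bᵤᵥ| ≤ 1`).
[folklore] -/
theorem abs_penaltyGrad_le {M : ℝ} (hM : 0 ≤ M) {B : Matrix V V ℝ} (hB : IsSpectraplex B) (u v : V) :
    |penaltyGrad H M B u v| ≤ 1 + 2 * M := by
  unfold penaltyGrad
  split_ifs
  · have h := hB.abs_apply_le_one u v
    rw [abs_le] at h ⊢
    constructor <;> nlinarith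
  · simp [hM]

omit [Fintype V] [DecidableEq V] in
/-- The diagonal of the gradient is `1` (the graph is loopless). [folklore] -/
theorem penaltyGrad_diag (M : ℝ) (B : Matrix V V ℝ) (u : V) : penaltyGrad H M B u u = 1 := by
  simp [penaltyGrad]

/-- **Curvature on the spectraplex**: `q(W - B) ≤ 4` for `B, W ∈ Δ`
(`q(W - B) ≤ ‖W - B‖_F² ≤ 2‖W‖_F² + 2‖B‖_F² ≤ 4`; Jaggi 2011, Lemma 23 gives the sharp `2`).
[cite: Jaggi2011, Lemma 23 (chunk p0024)] -/
theorem edgeSqSum_sub_le_four {B W : Matrix V V ℝ} (hB : IsSpectraplex B) (hW : IsSpectraplex W) :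
    edgeSqSum H (W - B) ≤ 4 := by
  have h1 := edgeSqSum_le_sum_sq (H := H) (W - B)
  have h2 : ∑ u, ∑ v, (W - B) u v ^ 2 ≤ 2 * ∑ u, ∑ v, W u v ^ 2 + 2 * ∑ u, ∑ v, B u v ^ 2 := by
    rw [mul_sum, mul_sum, ← sum_add_distrib]
    refine sum_le_sum fun u _ => ?_
    rw [mul_sum, mul_sum, ← sum_add_distrib]
    refine sum_le_sum fun v _ => ?_
    rw [Matrix.sub_apply]
    nlinarith [sq_nonneg (W u v + B u v)]
  linarith [hB.sum_sq_le_one, hW.sum_sq_le_one]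

/-! ### Extraction: a theta-feasible matrix near every point of the spectraplex -/

/-- **The extraction matrix is theta-feasible** for `B ∈ Δ` and `η ≥ |Bᵤᵥ|` on edges: it is
symmetric, positive semidefinite (`xᵀB_Ex ≤ |V| η xᵀx` by the Gershgorin-type bound), has trace one
and vanishes on the edges. [folklore] -/
theorem isThetaFeasible_extract {B : Matrix V V ℝ} (hB : IsSpectraplex B) {η : ℝ} (hη : 0 ≤ η)
    (hE : ∀ u v, H.Adj u v → |B u v| ≤ η) : IsThetaFeasible H (extract H η B) := by
  set n : ℝ := (Fintype.card V : ℝ) with hn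
  have hn0 : 0 ≤ n := Nat.cast_nonneg _
  have hc : 0 < 1 + n ^ 2 * η := by positivity
  -- the edge part: symmetric, entries bounded by `η`, zero diagonal
  have hEsymm : (edgePart H B).IsHermitian := by
    ext u v
    simp only [edgePart, conjTranspose_apply, star_trivial, H.adj_comm u v, hB.apply_comm u v]
  have hEbd : ∀ u v, |edgePart H B u v| ≤ η := fun u v => by
    unfold edgePart; split_ifs with h
    · exact hE u v h
    · simpa using hη
  -- positivity of `B - B_E + n η • 1`
  have hPSD : (B - edgePart H B + (n * η) • (1 : Matrix V V ℝ)).PosSemidef := by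
    have hherm : (B - edgePart H B + (n * η) • (1 : Matrix V V ℝ)).IsHermitian := by
      rw [Matrix.IsHermitian, conjTranspose_add, conjTranspose_sub, conjTranspose_smul,
        conjTranspose_one, star_trivial, hB.posSemidef.1.eq, hEsymm.eq]
    refine PosSemidef.of_dotProduct_mulVec_nonneg hherm fun x => ?_
    rw [star_trivial, add_mulVec, sub_mulVec, dotProduct_add, dotProduct_sub, smul_mulVec,
      one_mulVec, dotProduct_smul, smul_eq_mul]
    have h1 := hB.posSemidef.dotProduct_mulVec_nonneg x
    rw [star_trivial] at h1
    have h2 := abs_dotProduct_mulVec_le hEbd x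
    have h3 : x ⬝ᵥ (edgePart H B *ᵥ x) ≤ n * η * (x ⬝ᵥ x) := (le_abs_self _).trans h2
    linarith
  refine ⟨?_, ?_, ?_⟩
  · exact hPSD.smul (inv_nonneg.2 hc.le)
  · have htrE : (edgePart H B).trace = 0 := by
      simp [Matrix.trace, edgePart]
    rw [extract, trace_smul, trace_add, trace_sub, trace_smul, htrE, hB.trace_eq_one, trace_one,
      smul_eq_mul, smul_eq_mul, ← hn]
    field_simp
    ring
  · intro u v huv
    have hne : u ≠ v := huv.ne
    simp [extract, edgePart, huv, hne]

/-- The objective of the extraction matrix: `Σ (extract)ᵤᵥ ≥ Σ Bᵤᵥ - |V|³ η`. [folklore] -/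
theorem entrySum_extract_ge {B : Matrix V V ℝ} (hB : IsSpectraplex B) {η : ℝ} (hη : 0 ≤ η)
    (hE : ∀ u v, H.Adj u v → |B u v| ≤ η) :
    entrySum B - (Fintype.card V : ℝ) ^ 3 * η ≤ entrySum (extract H η B) := by
  set n : ℝ := (Fintype.card V : ℝ) with hn
  have hn0 : 0 ≤ n := Nat.cast_nonneg _
  have hc : 0 < 1 + n ^ 2 * η := by positivity
  have he0 := hB.entrySum_nonneg
  have hen := hB.entrySum_le_card
  rw [← hn] at hen
  -- the sum of the edge part is at most `n² η`
  have hEsum : entrySum (edgePart H B) ≤ n ^ 2 * η := by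
    calc entrySum (edgePart H B) ≤ ∑ _u : V, ∑ _v : V, η := by
          refine sum_le_sum fun u _ => sum_le_sum fun v _ => ?_
          unfold edgePart; split_ifs with h
          · exact (le_abs_self _).trans (hE u v h)
          · exact hη
      _ = n ^ 2 * η := by simp [hn, sq]; ring
  have hval : entrySum (extract H η B) =
      (1 + n ^ 2 * η)⁻¹ * (entrySum B - entrySum (edgePart H B) + n * η * n) := by
    rw [extract, entrySum_smul, entrySum_add, entrySum_sub, entrySum_smul, entrySum_one, ← hn]
  rw [hval, ← div_eq_inv_mul, le_div_iff₀ hc]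
  nlinarith [mul_nonneg (mul_nonneg hn0 hn0) hη, mul_nonneg hn0 hη,
    mul_nonneg (mul_nonneg (pow_nonneg hn0 2) hη) (sub_nonneg.2 hen),
    mul_nonneg (mul_nonneg (pow_nonneg hn0 3) hη) (mul_nonneg (pow_nonneg hn0 2) hη)]

/-- **Extraction of a lower bound on `ϑ`**: for `B ∈ Δ` with `|Bᵤᵥ| ≤ η` on the edges,
`Σᵤᵥ Bᵤᵥ - |V|³ η ≤ ϑ(H)`. [cite: Lovasz1979] -/
theorem entrySum_sub_le_lovaszTheta {B : Matrix V V ℝ} (hB : IsSpectraplex B) {η : ℝ} (hη : 0 ≤ η)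
    (hE : ∀ u v, H.Adj u v → |B u v| ≤ η) :
    entrySum B - (Fintype.card V : ℝ) ^ 3 * η ≤ lovaszTheta H :=
  (entrySum_extract_ge hB hη hE).trans
    (le_csSup (bddAbove_thetaValues H) ⟨_, isThetaFeasible_extract hB hη hE, rfl⟩)

/-- **The penalised objective never exceeds `ϑ` by more than `|V|⁶/(4M)`** on the spectraplex:
with `η = max_E |Bᵤᵥ|`, `f_M(B) = Σ B - M q(B) ≤ (ϑ + |V|³η) - Mη² ≤ ϑ + |V|⁶/(4M)`. [folklore] -/
theorem penaltyObj_le {M : ℝ} (hM : 0 < M) {B : Matrix V V ℝ} (hB : IsSpectraplex B) :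
    penaltyObj H M B ≤ lovaszTheta H + (Fintype.card V : ℝ) ^ 6 / (4 * M) := by
  set n : ℝ := (Fintype.card V : ℝ) with hn
  set S := (univ : Finset (V × V)).filter fun p => H.Adj p.1 p.2 with hS
  rcases S.eq_empty_or_nonempty with hSe | hSne
  · -- no edges: `B` itself is feasible up to `η = 0`
    have hE : ∀ u v, H.Adj u v → |B u v| ≤ 0 := fun u v h => by
      have : (u, v) ∈ S := mem_filter.2 ⟨mem_univ _, h⟩
      rw [hSe] at this; simp at this
    have h1 := entrySum_sub_le_lovaszTheta hB le_rfl hE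
    have h2 := edgeSqSum_nonneg (H := H) B
    rw [penaltyObj]
    have : (0 : ℝ) ≤ n ^ 6 / (4 * M) := by positivity
    nlinarith
  · set η := S.sup' hSne fun p => |B p.1 p.2| with hη
    have hE : ∀ u v, H.Adj u v → |B u v| ≤ η := fun u v h =>
      le_sup' (fun p : V × V => |B p.1 p.2|) (mem_filter.2 ⟨mem_univ (u, v), h⟩)
    obtain ⟨p₀, hp₀, hp₀η⟩ := exists_mem_eq_sup' hSne fun p => |B p.1 p.2|
    have hη0 : 0 ≤ η := by rw [hη, hp₀η]; exact abs_nonneg _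
    have hadj : H.Adj p₀.1 p₀.2 := (mem_filter.1 hp₀).2
    -- `q(B) ≥ η²`
    have hq : η ^ 2 ≤ edgeSqSum H B := by
      rw [hη, hp₀η, sq_abs]
      calc B p₀.1 p₀.2 ^ 2 = ∑ v ∈ ({p₀.2} : Finset V), if H.Adj p₀.1 v then B p₀.1 v ^ 2 else 0 := by
            simp [hadj]
        _ ≤ ∑ v, if H.Adj p₀.1 v then B p₀.1 v ^ 2 else 0 :=
            sum_le_sum_of_subset_of_nonneg (subset_univ _) fun v _ _ => by split_ifs <;> positivity
        _ ≤ edgeSqSum H B :=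
            single_le_sum (f := fun u => ∑ v, if H.Adj u v then B u v ^ 2 else 0)
              (fun u _ => sum_nonneg fun v _ => by split_ifs <;> positivity) (mem_univ p₀.1)
    have h1 := entrySum_sub_le_lovaszTheta hB hη0 hE
    rw [penaltyObj]
    -- `n³ η - M η² ≤ n⁶ / (4M)`
    have h3 : n ^ 3 * η - M * η ^ 2 ≤ n ^ 6 / (4 * M) := by
      rw [le_div_iff₀ (by positivity)]
      nlinarith [sq_nonneg (2 * M * η - n ^ 3)]
    nlinarith [mul_le_mul_of_nonneg_left hq hM.le]

end Literature.Combinatorics.SimpleGraph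

end
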